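import Summits.QuantumFields.YangMills.Theorems.BalabanUVNodesC44CjOfRecord
import Summits.QuantumFields.YangMills.Theorems.BalabanUVNodesC44IterMhLinearisation
import HarnessLib

/-!
# [B11] (44) AT THE RECORD — TANGENCY OF THE FAMILY: `D C_j^{𝔰𝔩}(0) = 0` FOR EVERY LEVEL `j` (◆ CRIT-1 g38 rider (R-g) on ✓`…C44CjOfRecord`, nodeO STATUS 2026-08-31 l.5595)

Cell `ym-nodeO-ideate` ∕ `pub-ymgap`, DEFINER seat `ym-nodeO-def-1` (gen 39); `--kind proof --supports stmt-QuantumFields-27238 --as helper`; count-neutral.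
[B11] = [Balaban1985Variational], [B9] = [Balaban1985BackgroundPropagators].

WHY.  ✓`…C44CjOfRecord` (p825209) types print's family `C_j(A′)(c) = (1∕i)·log(Ū^j_h(e^{iη_kA′}U₀)(c)·Ū^j(U₀)(c)⋆) − (L^jη_k)·(Q_j(U₀)A′)(c)` with ONE modelling choice:
print's factor `L^jη` of (44) «Q̄_j(L^jηA) = L^jηQ_jA + C_j(L^jηA)» against the tree's `L^{-j}`-normalised `qCplxOp j`.  ◆'s rider (R-g): before any (44)-type quadratic
letter over `C_j` is consumed at `j < k`, PROVE TANGENCY — if the factor were off by a power of `L`, `C_j` would carry a non-zero linear term and every quadratic letter over it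
would be unprovable.  This file discharges (R-g) for EVERY `j`: ★ PT-B g7's level-`k` proof (✓`…C44IterMhLinearisation` §4 `hasFDerivAt_CslOfRecord_zero`) read at level `j`
— its two engines ✓`hasDerivAt_logChart_iterMh_line` and ✓`fderiv_iterMh_mul_star_eq_qCplxOp` are generic in the level, and the factor `L^jη_k` is exactly what cancels
`η_k·L^j·Q_j` (no `L^kη_k = 1` needed).

WHAT THIS FILE PROVES (ns `…Theorems.C44IterMh`; 0 def):
* ★ `hasDerivAt_CslJOfRecord_line_zero` — under `SmallBelow (avOfRecord F N K) j U₀`, every line derivative `d∕dt|₀ C_j^{𝔰𝔩}(t·A′)(c)` vanishes (level-`j` bond `c`).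
* ★★ `hasFDerivAt_CslJOfRecord_zero : HasFDerivAt (CslJOfRecord F N K k Ω U₀ j levB) 0 0` and `fderiv_CslJOfRecord_zero` — the family member has NO linear term on print's
  `𝔤ᶜ`-valued (traceless) fields, for every `j` (at `j = k` this is PT-B's theorem again, via ✓`CslJOfRecord_top`).

HONEST FRAMING.  A tangency identity (bookkeeping about the definition's normalisation); NOTHING of the (44) ESTIMATE `|C_j| ≤ C₂(L^jη)²|A|²`, of Prop. 4, or of the general-Ω
edition of (ℓa-C) is asserted or proved; (ℓa-H), (ℓd), (R1)∕(R2) OPEN; K0ᴬ ⟨stmt-QuantumFields-27238⟩ NOT closed; K0ᴬ∕K1ᴬ∕K3ᴬ 0∕3; NODE O 0∕1; COUNT 8∕28 · K 1∕4 UNMOVED;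
finite `𝕋⁴_{L^K}` at fixed ε — NOT continuum ∕ ℝ⁴ ∕ OS; **the Yang–Mills mass gap (Clay) is NOT proved by any of this.**  No `sorry`, `instance`, `notation`; standard axioms.
-/

noncomputable section

open scoped Matrix Matrix.Norms.L2Operator InnerProductSpace ComplexConjugate Topology

namespace Summit.QuantumFields.YangMills.Theorems.C44IterMh

open Literature.MathematicalPhysics.QuantumFieldTheory.Balaban1983to89
open Literature.MathematicalPhysics.QuantumFieldTheory.Balaban1983to89.Node00
open T4Continuum BlockAveraging
open B15AveragingHolomorphic (iterMh)
open B11Eq115Space (NegSup NegSize levWeight JetSup)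
open ExpMeanLog (expMeanLogSU)
open Filter (Eventually)

variable (F : T4Family) (N : ℕ) [NeZero N] {K : ℕ} (k : ℕ) (Ω : ℕ → Set (Site (F.P K) 0)) (U₀ : GaugeField (F.P K) 0 (SU N))
variable [Fact (0 < (F.L : ℝ))] [Fact (0 < (F.P K).eta k)]

/-- ★ **THE LINE DERIVATIVES OF `C_j^{𝔰𝔩}` AT `0` VANISH, EVERY LEVEL `j`**: under the guard below `j`, for every `A′` and level-`j` bond `c`,
`d∕dt|₀ C_j^{𝔰𝔩}(t·A′)(c) = η_k·L^j·(Q_j(U₀)Y)(c) − (L^jη_k)·(Q_j(U₀)Y)(c) = 0` with `Y = ev(P A′)` traceless (✓`trace_equiv_slProjLit`) — ★ PT-B's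
✓`hasDerivAt_logChart_iterMh_line` + ✓`fderiv_iterMh_mul_star_eq_qCplxOp` at level `j`. [cite: Balaban1985Variational, (44) p.285, (51) p.286; Balaban1985BackgroundPropagators, (3.13) p.393] -/
theorem hasDerivAt_CslJOfRecord_line_zero (j : ℕ) (levB : PBond (F.P K) j → ℕ) (hU₀ : SmallBelow (avOfRecord F N K) j U₀) (A : Space115Lit F N K k Ω U₀)
    (c : PBond (F.P K) j) :
    HasDerivAt (fun t : ℂ => NegSup.equiv _ _ (CslJOfRecord F N K k Ω U₀ j levB (t • A)) c) 0 0 := by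
  set Y : PBond (F.P K) 0 → Matrix (Fin N) (Fin N) ℂ := evLit F N K k Ω U₀ (slProjLit F N K k Ω U₀ A) with hYdef
  set η : ℂ := ((((F.P K).eta k : ℝ) : ℂ)) with hη
  have hYtr : ∀ b, (Y b).trace = 0 := fun b => by
    rw [hYdef, evLit_apply]; exact trace_equiv_slProjLit (F := F) (N := N) (K := K) (k := k) (Ω := Ω) (U₀ := U₀) A _
  -- unfold the line: `C_j^{sl}(tA)(c) = (1/i) log(Ū^j_h(e^{t·(ηY)}U₀)(c)·W̄(c)⋆) − t·((L^jη)·(Q_j Y)(c))`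
  have hfun : (fun t : ℂ => NegSup.equiv _ _ (CslJOfRecord F N K k Ω U₀ j levB (t • A)) c)
      = fun t : ℂ => logOver (coeField (Averaging.iter (fun i => blockAvg (P := F.P K) (j := i) expMeanLogSU) j U₀))
            (iterMh j (expOver U₀ (t • (η • Y)))) c - t • (((F.L : ℂ) ^ j * η) • qCplxOp j U₀ Y c) := by
    funext t
    rw [CslJOfRecord_apply, map_smul, CjOfRecord_apply, map_smul, map_smul, smul_comm η t, Pi.smul_apply,
      smul_comm ((F.L : ℂ) ^ j * ((((F.P K).eta k : ℝ) : ℂ))) t, logOver_apply, coeField_apply]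
    rfl
  rw [hfun]
  have h1 := hasDerivAt_logChart_iterMh_line U₀ hU₀ (η • Y) c
  have h2 : HasDerivAt (fun t : ℂ => t • (((F.L : ℂ) ^ j * η) • qCplxOp j U₀ Y c)) (((F.L : ℂ) ^ j * η) • qCplxOp j U₀ Y c) 0 := by
    have h := (hasDerivAt_id (0 : ℂ)).smul_const (((F.L : ℂ) ^ j * η) • qCplxOp j U₀ Y c)
    rw [one_smul] at h
    exact h
  refine (h1.sub h2).congr_deriv ?_
  -- `D[(ηY)·U₀] c · W̄c⋆ − (L^jη)·Q Y c = η·L^j·Q Y c − (L^jη)·Q Y c = 0`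
  have hlin : (fun b => (η • Y) b * (U₀ b : Matrix (Fin N) (Fin N) ℂ)) = η • fun b => Y b * (U₀ b : Matrix (Fin N) (Fin N) ℂ) := by
    funext b; rw [Pi.smul_apply, Pi.smul_apply, smul_mul_assoc]
  rw [hlin, map_smul, Pi.smul_apply, smul_mul_assoc, fderiv_iterMh_mul_star_eq_qCplxOp U₀ hU₀ hYtr c, smul_smul, T4Family.P_L, mul_comm η, sub_self]

/-- ★★ **`D C_j^{𝔰𝔩}(0) = 0` FOR EVERY LEVEL `j`** (◆ rider (R-g) DISCHARGED): under the small-field guard of `U₀` below `j`,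
`HasFDerivAt (CslJOfRecord F N K k Ω U₀ j levB) 0 0` — the family member has NO linear term on print's `𝔤ᶜ`-valued fields; the factor `L^jη_k` of ✓`CjOfRecord` is the right
one.  From the line derivatives, ℂ-differentiability at `0` (✓`analyticAt_CslJOfRecord_zero`) and ✓`NegSup.continuousLinearEquiv` (★ PT-B's level-`k` argument verbatim).
[cite: Balaban1985Variational, (44) p.285, (55) p.286, (51) p.286; Balaban1985BackgroundPropagators, (3.13) p.393] -/
theorem hasFDerivAt_CslJOfRecord_zero (j : ℕ) (levB : PBond (F.P K) j → ℕ) (hU₀ : SmallBelow (avOfRecord F N K) j U₀) :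
    HasFDerivAt (CslJOfRecord F N K k Ω U₀ j levB) (0 : Space115Lit F N K k Ω U₀ →L[ℂ] NegSize (F.L : ℝ) ((F.P K).eta k) levB 0 (Matrix (Fin N) (Fin N) ℂ)) 0 := by
  have hd : DifferentiableAt ℂ (CslJOfRecord F N K k Ω U₀ j levB) 0 :=
    (analyticAt_CslJOfRecord_zero (F := F) (N := N) (K := K) (k := k) (Ω := Ω) (U₀ := U₀) j levB hU₀).differentiableAt
  have hF := hd.hasFDerivAt
  suffices h0 : fderiv ℂ (CslJOfRecord F N K k Ω U₀ j levB) 0 = 0 by rwa [h0] at hF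
  ext A
  change fderiv ℂ (CslJOfRecord F N K k Ω U₀ j levB) 0 A = 0
  set E := NegSup.continuousLinearEquiv ℂ (V := Matrix (Fin N) (Fin N) ℂ) (levWeight (F.L : ℝ) ((F.P K).eta k) levB 0) with hE
  have hline : HasDerivAt (fun t : ℂ => t • A) A 0 := by
    have h := (hasDerivAt_id (0 : ℂ)).smul_const A
    rw [one_smul] at h
    exact h
  have hEF : HasFDerivAt (fun A' => E (CslJOfRecord F N K k Ω U₀ j levB A'))
      ((E : NegSize (F.L : ℝ) ((F.P K).eta k) levB 0 (Matrix (Fin N) (Fin N) ℂ) →L[ℂ] (PBond (F.P K) j → Matrix (Fin N) (Fin N) ℂ)).comp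
        (fderiv ℂ (CslJOfRecord F N K k Ω U₀ j levB) 0)) 0 :=
    E.hasFDerivAt.comp 0 hF
  have hcurve := hEF.comp_hasDerivAt_of_eq (0 : ℂ) hline (zero_smul ℂ A).symm
  have hzero : HasDerivAt ((fun A' => E (CslJOfRecord F N K k Ω U₀ j levB A')) ∘ fun t : ℂ => t • A) 0 0 := by
    refine hasDerivAt_pi.2 fun c => ?_
    have h := hasDerivAt_CslJOfRecord_line_zero F N k Ω U₀ j levB hU₀ A c
    exact h.congr_of_eventuallyEq (Eventually.of_forall fun t => rfl)
  have huniq : ((E : NegSize (F.L : ℝ) ((F.P K).eta k) levB 0 (Matrix (Fin N) (Fin N) ℂ) →L[ℂ] (PBond (F.P K) j → Matrix (Fin N) (Fin N) ℂ)).comp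
      (fderiv ℂ (CslJOfRecord F N K k Ω U₀ j levB) 0)) A = 0 := hcurve.unique hzero
  rw [ContinuousLinearMap.comp_apply] at huniq
  exact E.injective (by rw [map_zero]; exact huniq)

/-- Equivalently: `fderiv ℂ (CslJOfRecord … j levB) 0 = 0`. [cite: Balaban1985Variational, (44) p.285, (55) p.286] -/
theorem fderiv_CslJOfRecord_zero (j : ℕ) (levB : PBond (F.P K) j → ℕ) (hU₀ : SmallBelow (avOfRecord F N K) j U₀) :
    fderiv ℂ (CslJOfRecord F N K k Ω U₀ j levB) 0 = 0 :=
  (hasFDerivAt_CslJOfRecord_zero F N k Ω U₀ j levB hU₀).fderiv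

end Summit.QuantumFields.YangMills.Theorems.C44IterMh

end
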